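import Literature.AnabelianGeometry.SemiGraphs.CosetCategories
import HarnessLib

/-!
# [FrdII] Example 1.3 (ii): the pull-back functor of coset categories is FUNCTORIAL in the augmentation —
# `pull aug₁ ⋙ pull aug₂ = pull (aug₁ ∘ aug₂)` and `pull id = 𝟭` as EQUALITIES of functors

Mochizuki, *The geometry of Frobenioids II*, Kyushu J. Math. **62** (2008), §1 Example 1.3 (ii), author's text p. 11
[cite: MochizukiFrdII2008, Ex 1.3 (ii) p.11]: for a surjection `φ : Π₁ → Π₂` «the natural pull-back functor
`𝓑^temp(Π₂)⁰ → 𝓑^temp(Π₁)⁰`» — regarding a `Π₂`-set as a `Π₁`-set through `φ`; doing this along `Π₃ → Π₂ → Π₁` in two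
steps or in one step is THE SAME operation.  Mochizuki, *Inter-universal Teichmüller Theory II*, Remark 3.8.1 p. 115
«an "isomorphism of categories" is to be understood as an isomorphism class of equivalences of categories»
[cite: Mochizuki2012, Rmk 3.8.1 p.115] (why an on-the-nose composition law for the base change is wanted downstream).

abc-iut cell; row «PULL-COMP-ISO» (abc-iut-L6-lead §F v1.19cq, for MERGE-MAP R-Def38-a form (b): composites of the
Frobenioid functors `frobenioidMapOfPairIso σᵢ` of [IUTchII] Def 3.8 / Cor 3.7 (i) over RE-FACTORIZED base changes), seat
abc-iut-L6-t7 gen 6, filed in abc-iut-L3-lead's directory next to abc-iut-L5-t2's `CosetCategories.lean` (G13 announced to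
L3-lead / L5-lead).  PROOF-ONLY (0 `def` / `structure` / `instance`, no new `Prop` fact) over abc-iut-L5-t2's `CosetCat`,
`CosetCat.pull aug hc hs` (`obj X := ⟨X.sg.comap aug hc⟩`, maps conjugated by `quotAugEquiv`), `pullEquiv`, `pullEquiv_coe`,
`pull_map_toFun`, `hom_ext_toFun` — nothing re-declared.

WHAT IS PROVED.
* `pull_obj_comp`, `pull_obj_id` — on OBJECTS the composite / identity laws hold DEFINITIONALLY (`rfl`: Mathlib's
  `Subgroup.comap_comap` and `comap_id` are definitional), which is what makes the following EQUALITIES of functors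
  type-check without transport;
* **`CosetCat.pull_comp : pull aug₁ hc₁ hs₁ ⋙ pull aug₂ hc₂ hs₂ = pull (aug₁.comp aug₂) hc₁₂ hs₁₂`** (for ANY witnesses
  `hc₁₂`, `hs₁₂` of the composite — proofs are irrelevant, and this keeps the statement free of coercion bookkeeping) and
  **`CosetCat.pull_id : pull (MonoidHom.id G) continuous_id surjective_id = 𝟭 (CosetCat G)`** (via `Functor.hext`; on
  morphisms both sides send the coset of `π` to the coset of a lift of the image point — `pull_map_toFun_coe`);
* the named isomorphisms asked for by the row are then `eqToIso (pull_comp …)` / `eqToIso pull_id` — written inline by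
  consumers, no definition needed (`nonempty_pullCompIso` records their existence).
Pure topological-group / category bookkeeping over Mathlib and the landed `CosetCategories`; nothing of the disputed
series is asserted; no side taken on [IUTchIII] Cor 3.12.
-/

noncomputable section

namespace Literature.AnabelianGeometry.SemiGraphs

namespace CosetCat

open CategoryTheory Function

universe u

variable {G : Type u} [Group G] [TopologicalSpace G] {P₁ : Type u} [Group P₁] [TopologicalSpace P₁]
  {P₂ : Type u} [Group P₂] [TopologicalSpace P₂]
  (aug₁ : P₁ →* G) (hc₁ : Continuous aug₁) (hs₁ : Surjective aug₁)
  (aug₂ : P₂ →* P₁) (hc₂ : Continuous aug₂) (hs₂ : Surjective aug₂)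
  (hc₁₂ : Continuous (aug₁.comp aug₂)) (hs₁₂ : Surjective (aug₁.comp aug₂))

/-! ### Objects: the laws hold definitionally -/

/-- On objects, pulling back along `aug₁` then `aug₂` IS pulling back along `aug₁ ∘ aug₂` (`(aug₁∘aug₂)⁻¹V = aug₂⁻¹(aug₁⁻¹V)`,
definitionally). [cite: MochizukiFrdII2008, Ex 1.3 (ii) p.11] -/
theorem pull_obj_comp (X : CosetCat G) :
    (pull aug₂ hc₂ hs₂).obj ((pull aug₁ hc₁ hs₁).obj X) = (pull (aug₁.comp aug₂) hc₁₂ hs₁₂).obj X :=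
  rfl

/-- On objects, pulling back along the identity is the identity (definitionally). [cite: MochizukiFrdII2008, Ex 1.3 (ii) p.11] -/
theorem pull_obj_id (X : CosetCat G) : (pull (MonoidHom.id G) continuous_id surjective_id).obj X = X := rfl

/-! ### Morphisms: the pulled-back map on cosets -/

/-- The pulled-back map `(pull aug).map f` sends the coset of `π` to the coset of ANY lift `π'` of a representative of the
image point: if `f(aug π · U) = aug π' · V` then `(pull f)(π · aug⁻¹U) = π' · aug⁻¹V`. [cite: MochizukiFrdII2008, Ex 1.3 (ii) p.11] -/
theorem pull_map_toFun_coe {P : Type u} [Group P] [TopologicalSpace P] (aug : P →* G) (hc : Continuous aug)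
    (hs : Surjective aug) {X Y : CosetCat G} (f : X ⟶ Y) (π π' : P)
    (h : Hom.toFun f ((aug π : G) : X.carrier) = ((aug π' : G) : Y.carrier)) :
    Hom.toFun ((pull aug hc hs).map f) ((π : P) : ((pull aug hc hs).obj X).carrier) =
      ((π' : P) : ((pull aug hc hs).obj Y).carrier) := by
  rw [pull_map_toFun, Equiv.symm_apply_eq, pullEquiv_coe, pullEquiv_coe, h]

/-! ### The composite law and the unit law as equalities of functors -/

/-- **`pull aug₁ ⋙ pull aug₂ = pull (aug₁ ∘ aug₂)`** — the pull-back functor of [FrdII] Ex. 1.3 (ii) is functorial in the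
augmentation, ON THE NOSE: objects agree definitionally (`pull_obj_comp`), and on a morphism `f : G/U → G/V` both sides send
the coset of `π ∈ P₂` to the coset of a lift `π'` of a representative of `f(aug₁(aug₂ π)·U)` (two-step lift = one-step lift).
[cite: MochizukiFrdII2008, Ex 1.3 (ii) p.11] -/
theorem pull_comp :
    pull aug₁ hc₁ hs₁ ⋙ pull aug₂ hc₂ hs₂ = pull (aug₁.comp aug₂) hc₁₂ hs₁₂ := by
  refine Functor.hext (fun _ => rfl) fun X Y f => heq_of_eq ?_
  apply hom_ext_toFun
  intro x
  obtain ⟨π, rfl⟩ := QuotientGroup.mk_surjective x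
  -- a representative of the image point, lifted through the composite surjection
  obtain ⟨g, hg⟩ := QuotientGroup.mk_surjective (Hom.toFun f ((aug₁ (aug₂ π) : G) : X.carrier))
  obtain ⟨π', rfl⟩ := hs₁₂ g
  have h : Hom.toFun f ((aug₁ (aug₂ π) : G) : X.carrier) = ((aug₁ (aug₂ π') : G) : Y.carrier) := hg.symm
  -- the one-step side
  have hR : Hom.toFun ((pull (aug₁.comp aug₂) hc₁₂ hs₁₂).map f)
      ((π : P₂) : ((pull (aug₁.comp aug₂) hc₁₂ hs₁₂).obj X).carrier) =
        ((π' : P₂) : ((pull (aug₁.comp aug₂) hc₁₂ hs₁₂).obj Y).carrier) :=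
    pull_map_toFun_coe (aug₁.comp aug₂) hc₁₂ hs₁₂ f π π' h
  -- the two-step side: first along `aug₁` (lift `aug₂ π ↦ aug₂ π'`), then along `aug₂` (lift `π ↦ π'`)
  have h₁ : Hom.toFun ((pull aug₁ hc₁ hs₁).map f) ((aug₂ π : P₁) : ((pull aug₁ hc₁ hs₁).obj X).carrier) =
      ((aug₂ π' : P₁) : ((pull aug₁ hc₁ hs₁).obj Y).carrier) :=
    pull_map_toFun_coe aug₁ hc₁ hs₁ f (aug₂ π) (aug₂ π') h
  have hL : Hom.toFun ((pull aug₂ hc₂ hs₂).map ((pull aug₁ hc₁ hs₁).map f))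
      ((π : P₂) : ((pull aug₂ hc₂ hs₂).obj ((pull aug₁ hc₁ hs₁).obj X)).carrier) =
        ((π' : P₂) : ((pull aug₂ hc₂ hs₂).obj ((pull aug₁ hc₁ hs₁).obj Y)).carrier) :=
    pull_map_toFun_coe aug₂ hc₂ hs₂ ((pull aug₁ hc₁ hs₁).map f) π π' h₁
  exact hL.trans hR.symm

/-- **`pull id = 𝟭`**: pulling back along the identity of `G` is the identity functor of `CosetCat G`, on the nose.
[cite: MochizukiFrdII2008, Ex 1.3 (ii) p.11] -/
theorem pull_id : pull (MonoidHom.id G) continuous_id surjective_id = 𝟭 (CosetCat G) := by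
  refine Functor.hext (fun _ => rfl) fun X Y f => heq_of_eq ?_
  apply hom_ext_toFun
  intro x
  obtain ⟨π, rfl⟩ := QuotientGroup.mk_surjective x
  obtain ⟨π', hπ'⟩ := QuotientGroup.mk_surjective (Hom.toFun f ((π : G) : X.carrier))
  have h : Hom.toFun f (((MonoidHom.id G) π : G) : X.carrier) = (((MonoidHom.id G) π' : G) : Y.carrier) := hπ'.symm
  exact (pull_map_toFun_coe (MonoidHom.id G) continuous_id surjective_id f π π' h).trans hπ'

/-- The composite of three pull-backs: every iterated pull-back is `pull` of the composite augmentation.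
[cite: MochizukiFrdII2008, Ex 1.3 (ii) p.11] -/
theorem pull_comp₃ {P₃ : Type u} [Group P₃] [TopologicalSpace P₃] (aug₃ : P₃ →* P₂) (hc₃ : Continuous aug₃)
    (hs₃ : Surjective aug₃) (hc₁₂₃ : Continuous ((aug₁.comp aug₂).comp aug₃)) (hs₁₂₃ : Surjective ((aug₁.comp aug₂).comp aug₃)) :
    pull aug₁ hc₁ hs₁ ⋙ pull aug₂ hc₂ hs₂ ⋙ pull aug₃ hc₃ hs₃ = pull ((aug₁.comp aug₂).comp aug₃) hc₁₂₃ hs₁₂₃ := by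
  have hc₂₃ : Continuous (aug₂.comp aug₃) := hc₂.comp hc₃
  have hs₂₃ : Surjective (aug₂.comp aug₃) := hs₂.comp hs₃
  rw [pull_comp aug₂ hc₂ hs₂ aug₃ hc₃ hs₃ hc₂₃ hs₂₃, pull_comp aug₁ hc₁ hs₁ (aug₂.comp aug₃) hc₂₃ hs₂₃ hc₁₂₃ hs₁₂₃]
  rfl

/-- `pull` depends only on the augmentation (the continuity / surjectivity witnesses are proofs).
[cite: MochizukiFrdII2008, Ex 1.3 (ii) p.11] -/
theorem pull_congr {P : Type u} [Group P] [TopologicalSpace P] (aug aug' : P →* G) (hc : Continuous aug)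
    (hc' : Continuous aug') (hs : Surjective aug) (hs' : Surjective aug') (h : aug = aug') :
    pull aug hc hs = pull aug' hc' hs' := by
  subst h
  rfl

/-- **Two factorizations of the same augmentation give the same pull-back**: if `aug₁ ∘ aug₂ = aug₃ ∘ aug₄` as
homomorphisms `P₂ → G`, then `pull aug₁ ⋙ pull aug₂ = pull aug₃ ⋙ pull aug₄` — the base-level square behind the
«compatible collections of isomorphisms» of [IUTchII] Cor 3.7 (i) read over re-factorized group identifications.
[cite: MochizukiFrdII2008, Ex 1.3 (ii) p.11] -/
theorem pull_comp_eq_pull_comp {P₁' : Type u} [Group P₁'] [TopologicalSpace P₁'] (aug₃ : P₁' →* G) (hc₃ : Continuous aug₃)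
    (hs₃ : Surjective aug₃) (aug₄ : P₂ →* P₁') (hc₄ : Continuous aug₄) (hs₄ : Surjective aug₄)
    (h : aug₁.comp aug₂ = aug₃.comp aug₄) :
    pull aug₁ hc₁ hs₁ ⋙ pull aug₂ hc₂ hs₂ = pull aug₃ hc₃ hs₃ ⋙ pull aug₄ hc₄ hs₄ := by
  have hc : Continuous (aug₁.comp aug₂) := hc₁.comp hc₂
  have hs : Surjective (aug₁.comp aug₂) := hs₁.comp hs₂
  have hc' : Continuous (aug₃.comp aug₄) := hc₃.comp hc₄
  have hs' : Surjective (aug₃.comp aug₄) := hs₃.comp hs₄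
  rw [pull_comp aug₁ hc₁ hs₁ aug₂ hc₂ hs₂ hc hs, pull_comp aug₃ hc₃ hs₃ aug₄ hc₄ hs₄ hc' hs']
  exact pull_congr _ _ _ _ _ _ h

/-- The isomorphism of functors asked for by the row «PULL-COMP-ISO» exists canonically: `eqToIso (pull_comp …)`.
[cite: MochizukiFrdII2008, Ex 1.3 (ii) p.11] -/
theorem nonempty_pullCompIso :
    Nonempty (pull aug₁ hc₁ hs₁ ⋙ pull aug₂ hc₂ hs₂ ≅ pull (aug₁.comp aug₂) hc₁₂ hs₁₂) :=
  ⟨eqToIso (pull_comp aug₁ hc₁ hs₁ aug₂ hc₂ hs₂ hc₁₂ hs₁₂)⟩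

end CosetCat

end Literature.AnabelianGeometry.SemiGraphs

end
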